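import Summits.CriticalPhenomena.CardyFormulaZ2.Theorems.CardyComplexConeParafermionToSLESixFamiliesDiamondDartPhaseGadget
import Literature.Probability.LatticeModels.MedialCornerWalkRuns
import HarnessLib

/-!
# The signed turning of the three routes and the quarter turn per diamond corner
# (line `potential-darboux-picard-diamond`, S1p `stub_boundaryDartPhase`, part 3)

Crux `ParafermionToSLESixFamilies` (stmt-CriticalPhenomena-11389), line `potential-darboux-picard-diamond`, stub
`stub_boundaryDartPhase` (S1p). The turn count of the exploration at a boundary dart of side `k` escaping through the route
`Q` and the gadget `(gds, g)` is `T = -4 - ((-1 + walkTurns (k + 1) Q) + g)` (`turnCount_touchSite`). Here the routes'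
turnings are computed (`walkTurns_routeBot/Top/East`: `-2 + walkTurns (k+3) gds`, `-4 + walkTurns (k+1) gds`,
`-5 + walkTurns k gds` — one right quarter turn per box corner and one into the approach), whence with
`add_walkTurns_gadget` the three values `T = -1 - (k₀ - k + 1).val`, `1 - (k₀ - k + 3).val`, `2 - (k₀ - k).val`
(`turnValue_bot/top/east`). Reading the side `k = k⋆ + r` of the dart relative to the side `k⋆` beyond which the outer
corner `p⋆` of the start edge lies, the five route classes (bottom on `k⋆` with the mark before the segment, bottom on
`k⋆ + 1`, top on `k⋆ + 2`, east on `k⋆ + 3`, east on `k⋆` with the mark after the segment) give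
`T = T⋆ + 0, 1, 2, 3, 4` with `T⋆ = -2 - (k₀ - k⋆).val` (`turnValue_classes`, registered): ONE QUARTER TURN PER DIAMOND
CORNER counter-clockwise from the mark at the start edge, and a full turn across that mark — provided `k₀ ≠ k⋆ - 1`, which
`startIndex_ne` derives from `p⋆` being beyond side `k⋆` and `x₀` inside. Also: the frame coordinates of the four sides in
terms of one (`Fk_succ`, …).
-/

noncomputable section

namespace Summit.CriticalPhenomena.CardyFormulaZ2.Cruxes.ParafermionToSLESixFamilies.PotentialDarbouxPicardDiamond

open Complex
open Literature.Probability Literature.Probability.LatticeModels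

/-! ## Runs and routes -/

/-- **A nonempty straight run entered at `a`**: one turn `(d + 3 - a).val - 1` at its first vertex, none inside, and the
continuation is entered at `d + 2`. -/
theorem walkTurns_run (a d : Fin 4) (n : ℕ) (rest : List (Fin 4)) :
    walkTurns a (List.replicate (n + 1) d ++ rest) = (((d + 3 - a).val : ℕ) : ℤ) - 1 + walkTurns (d + 2) rest := by
  rw [List.replicate_succ, List.cons_append, walkTurns, walkTurns_replicate_append]

/-- A positive integer length is a successor. -/
theorem toNat_eq_succ {z : ℤ} (hz : 1 ≤ z) : ∃ m : ℕ, z.toNat = m + 1 :=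
  ⟨z.toNat - 1, by omega⟩

variable (k : Fin 4) (K : ℤ) (p : Site 2) (gds : List (Fin 4))

/-- **Turning of the bottom route**: right at the far corner, right into the approach column. -/
theorem walkTurns_routeBot (h1 : 1 ≤ K - xiC k p) (h2 : 1 ≤ upC k p + K) :
    walkTurns (k + 1) (routeBot k K p gds) = -2 + walkTurns (k + 3) gds := by
  obtain ⟨m1, hm1⟩ := toNat_eq_succ h1
  obtain ⟨m2, hm2⟩ := toNat_eq_succ h2
  have c1 : ∀ k : Fin 4, ((k + 2 + 3 - (k + 1)).val : ℕ) = 0 ∧ k + 2 + 2 = k := by decide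
  have c2 : ∀ k : Fin 4, ((k + 1 + 3 - k).val : ℕ) = 0 ∧ k + 1 + 2 = k + 3 := by decide
  rw [routeBot, hm1, hm2, List.append_assoc, walkTurns_run, (c1 k).1, (c1 k).2, walkTurns_run, (c2 k).1, (c2 k).2]
  ring

/-- **Turning of the top route**: four rights around three box corners and into the approach column. -/
theorem walkTurns_routeTop (h0 : 1 ≤ 2 * K) (h1 : 1 ≤ xiC k p + K) (h2 : 1 ≤ K - upC k p) :
    walkTurns (k + 1) (routeTop k K p gds) = -4 + walkTurns (k + 1) gds := by
  obtain ⟨m0, hm0⟩ := toNat_eq_succ h0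
  obtain ⟨m1, hm1⟩ := toNat_eq_succ h1
  obtain ⟨m2, hm2⟩ := toNat_eq_succ h2
  have c1 : ∀ k : Fin 4, ((k + 2 + 3 - (k + 1)).val : ℕ) = 0 ∧ k + 2 + 2 = k := by decide
  have c2 : ∀ k : Fin 4, ((k + 1 + 3 - k).val : ℕ) = 0 ∧ k + 1 + 2 = k + 3 := by decide
  have c3 : ∀ k : Fin 4, ((k + 3 - (k + 3)).val : ℕ) = 0 := by decide
  have c4 : ∀ k : Fin 4, ((k + 3 + 3 - (k + 2)).val : ℕ) = 0 ∧ k + 3 + 2 = k + 1 := by decide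
  rw [routeTop, hm0, hm1, hm2, List.append_assoc, List.append_assoc, List.append_assoc, walkTurns_run, (c1 k).1, (c1 k).2,
    walkTurns_run, (c2 k).1, (c2 k).2, walkTurns_run, c3, walkTurns_run, (c4 k).1, (c4 k).2]
  ring

/-- **Turning of the east route**: five rights, around the four box corners and into the approach row. -/
theorem walkTurns_routeEast (h0 : 1 ≤ 2 * K) (h1 : 1 ≤ K - upC k p) (h2 : 1 ≤ K - xiC k p) :
    walkTurns (k + 1) (routeEast k K p gds) = -5 + walkTurns k gds := by
  obtain ⟨m0, hm0⟩ := toNat_eq_succ h0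
  obtain ⟨m1, hm1⟩ := toNat_eq_succ h1
  obtain ⟨m2, hm2⟩ := toNat_eq_succ h2
  have c1 : ∀ k : Fin 4, ((k + 2 + 3 - (k + 1)).val : ℕ) = 0 ∧ k + 2 + 2 = k := by decide
  have c2 : ∀ k : Fin 4, ((k + 1 + 3 - k).val : ℕ) = 0 ∧ k + 1 + 2 = k + 3 := by decide
  have c3 : ∀ k : Fin 4, ((k + 3 - (k + 3)).val : ℕ) = 0 := by decide
  have c4 : ∀ k : Fin 4, ((k + 3 + 3 - (k + 2)).val : ℕ) = 0 ∧ k + 3 + 2 = k + 1 := by decide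
  rw [routeEast, hm0, hm1, hm2, List.append_assoc, List.append_assoc, List.append_assoc, List.append_assoc, walkTurns_run,
    (c1 k).1, (c1 k).2, walkTurns_run, (c2 k).1, (c2 k).2, walkTurns_run, c3, walkTurns_run, (c4 k).1, (c4 k).2,
    walkTurns_run, (c1 k).1, (c1 k).2]
  ring

/-! ## The three turn-count values -/

variable {k K p gds} {k₀ : Fin 4} {g : ℤ}

/-- **The turn count through the bottom route**: `-1 - (k₀ - k + 1).val`. -/
theorem turnValue_bot (hg : (gds = [k₀ + 1] ∧ g = 1) ∨ (gds = [k₀ + 1, k₀ + 2] ∧ g = 0)) (h1 : 1 ≤ K - xiC k p)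
    (h2 : 1 ≤ upC k p + K) :
    -4 - ((-1 + walkTurns (k + 1) (routeBot k K p gds)) + g) = -1 - ((k₀ - k + 1).val : ℕ) := by
  have e : ∀ k₀ k : Fin 4, k₀ - (k + 3) = k₀ - k + 1 := by decide
  rw [walkTurns_routeBot k K p gds h1 h2, ← e]
  have := add_walkTurns_gadget k₀ (k + 3) hg
  linarith

/-- **The turn count through the top route**: `1 - (k₀ - k + 3).val`. -/
theorem turnValue_top (hg : (gds = [k₀ + 1] ∧ g = 1) ∨ (gds = [k₀ + 1, k₀ + 2] ∧ g = 0)) (h0 : 1 ≤ 2 * K)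
    (h1 : 1 ≤ xiC k p + K) (h2 : 1 ≤ K - upC k p) :
    -4 - ((-1 + walkTurns (k + 1) (routeTop k K p gds)) + g) = 1 - ((k₀ - k + 3).val : ℕ) := by
  have e : ∀ k₀ k : Fin 4, k₀ - (k + 1) = k₀ - k + 3 := by decide
  rw [walkTurns_routeTop k K p gds h0 h1 h2, ← e]
  have := add_walkTurns_gadget k₀ (k + 1) hg
  linarith

/-- **The turn count through the east route**: `2 - (k₀ - k).val`. -/
theorem turnValue_east (hg : (gds = [k₀ + 1] ∧ g = 1) ∨ (gds = [k₀ + 1, k₀ + 2] ∧ g = 0)) (h0 : 1 ≤ 2 * K)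
    (h1 : 1 ≤ K - upC k p) (h2 : 1 ≤ K - xiC k p) :
    -4 - ((-1 + walkTurns (k + 1) (routeEast k K p gds)) + g) = 2 - ((k₀ - k).val : ℕ) := by
  rw [walkTurns_routeEast k K p gds h0 h1 h2]
  have := add_walkTurns_gadget k₀ k hg
  linarith

/-! ## One quarter turn per diamond corner -/

/-- `Fin 4` arithmetic: `(d + 1).val = d.val + 1` unless `d = 3`. -/
theorem fin4_val_add_one {d : Fin 4} (h : d ≠ 3) : (((d + 1).val : ℕ) : ℤ) = d.val + 1 := by
  revert d; decide

/-- **One quarter turn per diamond corner** (registered helper of `stub_boundaryDartPhase`). With `k⋆` the side beyond which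
`p⋆` lies and `k₀ ≠ k⋆ - 1`, the five route classes — bottom on side `k⋆`, bottom on `k⋆ + 1`, top on `k⋆ + 2`, east on
`k⋆ + 3`, east on `k⋆` — have turn counts `T⋆, T⋆ + 1, T⋆ + 2, T⋆ + 3, T⋆ + 4` with `T⋆ = -2 - (k₀ - k⋆).val`. -/
theorem turnValue_classes : ∀ (k₀ kp : Fin 4), k₀ - kp ≠ 3 → (-1 - ((k₀ - kp + 1).val : ℕ) : ℤ) = -2 - ((k₀ - kp).val : ℕ) ∧ (-1 - ((k₀ - (kp + 1) + 1).val : ℕ) : ℤ) = -2 - ((k₀ - kp).val : ℕ) + 1 ∧ (1 - ((k₀ - (kp + 2) + 3).val : ℕ) : ℤ) = -2 - ((k₀ - kp).val : ℕ) + 2 ∧ (2 - ((k₀ - (kp + 3)).val : ℕ) : ℤ) = -2 - ((k₀ - kp).val : ℕ) + 3 ∧ (2 - ((k₀ - kp).val : ℕ) : ℤ) = -2 - ((k₀ - kp).val : ℕ) + 4 := by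
  intro k₀ kp h
  have e1 : k₀ - (kp + 1) + 1 = k₀ - kp := by abel
  have e2 : k₀ - (kp + 2) + 3 = k₀ - kp + 1 := by
    have : ∀ k₀ kp : Fin 4, k₀ - (kp + 2) + 3 = k₀ - kp + 1 := by decide
    exact this k₀ kp
  have e3 : k₀ - (kp + 3) = k₀ - kp + 1 := by
    have : ∀ k₀ kp : Fin 4, k₀ - (kp + 3) = k₀ - kp + 1 := by decide
    exact this k₀ kp
  rw [e1, e2, e3, fin4_val_add_one h]
  refine ⟨by ring, by ring, by ring, by ring, by ring⟩

/-! ## The four frames in terms of one -/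

/-- Frame of the next side. -/
theorem Fk_succ (k : Fin 4) (w : ℂ) : Fk (k + 1) w = Gk k w ∧ Gk (k + 1) w = -Fk k w := by
  fin_cases k <;> simp [Fk, Gk]

/-- Frame of the opposite side. -/
theorem Fk_add_two (k : Fin 4) (w : ℂ) : Fk (k + 2) w = -Fk k w ∧ Gk (k + 2) w = -Gk k w := by
  fin_cases k <;> simp [Fk, Gk]

/-- Frame of the previous side. -/
theorem Fk_add_three (k : Fin 4) (w : ℂ) : Fk (k + 3) w = -Gk k w ∧ Gk (k + 3) w = Fk k w := by
  fin_cases k <;> simp [Fk, Gk]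

/-- Half-widths of the other sides. -/
theorem gam_succ (α β : ℝ) (k : Fin 4) : gam α β (k + 1) = gam' α β k ∧ gam' α β (k + 1) = gam α β k ∧
    gam α β (k + 2) = gam α β k ∧ gam' α β (k + 2) = gam' α β k ∧ gam α β (k + 3) = gam' α β k ∧ gam' α β (k + 3) = gam α β k := by
  fin_cases k <;> simp [gam, gam']

/-! ## The index of the start corner relative to the side of `p⋆` -/

/-- **The start corner does not point away from the side of `p⋆`**: if the outer corner `p⋆` of the start edge
(`x₀ + u_{k₀+3}` or `x₀ + u_{k₀+3} + u_{k₀}`) lies beyond side `k⋆` while `x₀` does not, then `k₀ ≠ k⋆ - 1`. -/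
theorem startIndex_ne {c : ℂ} {δ α β : ℝ} (hδ : 0 < δ) {x₀ ps : Site 2} {k₀ kp : Fin 4}
    (hps : ps = x₀ + cornerUnit (k₀ + 3) ∨ ps = x₀ + cornerUnit (k₀ + 3) + cornerUnit k₀)
    (hin : Fk kp (dRot c (meshPoint δ x₀)) < gam α β kp) (hout : gam α β kp ≤ Fk kp (dRot c (meshPoint δ ps))) :
    k₀ - kp ≠ 3 := by
  intro h
  have hk : k₀ = kp + 3 := by
    have := congrArg (· + kp) h
    rw [add_comm kp]; simpa using this
  subst hk
  have e1 : kp + 3 + 3 = kp + 2 := by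
    have : ∀ kp : Fin 4, kp + 3 + 3 = kp + 2 := by decide
    exact this kp
  have hF := Fk_meshPoint_sub c δ kp ps x₀
  have hnonpos : (xiC kp ps - upC kp ps - (xiC kp x₀ - upC kp x₀) : ℤ) ≤ 0 := by
    rcases hps with rfl | rfl
    · rw [e1]; simp only [xiC_add_unit2, upC_add_unit2]; omega
    · rw [e1]; simp only [xiC_add_unit3, upC_add_unit3, xiC_add_unit2, upC_add_unit2]; omega
  have hnonpos' : ((xiC kp ps - upC kp ps - (xiC kp x₀ - upC kp x₀) : ℤ) : ℝ) ≤ 0 := by exact_mod_cast hnonpos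
  have : Real.sqrt 2 / 2 * δ * ((xiC kp ps - upC kp ps - (xiC kp x₀ - upC kp x₀) : ℤ) : ℝ) ≤ 0 :=
    mul_nonpos_of_nonneg_of_nonpos (by positivity) hnonpos'
  linarith

end Summit.CriticalPhenomena.CardyFormulaZ2.Cruxes.ParafermionToSLESixFamilies.PotentialDarbouxPicardDiamond

end
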